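import Literature.AnabelianGeometry.EtaleTheta.ThetaSubquotientOfTemperedAutImage

/-!
# [EtTh] §5: the stub laws `hLi` / `hLc`-on-the-Galois-locus at the GENUINE §5 data over `B^temp(Π^tp_X)⁰` with print's image carrier

Mochizuki, *The étale theta function and its Frobenioid-theoretic manifestations*, Publ. RIMS **45** (2009), §5 p. 327 (PDF p. 101),
proof of Prop. 5.5 p. 328 (PDF p. 102).  [cite: MochizukiEtTh2009, Prop 5.5 proof p.328 (PDF p.102)]

PROOF-ONLY (no definitions).  abc-iut cell, seat abc-iut-w5-d020 (gen 4), sequel of `ThetaSubquotientOfTemperedAutImage.lean` (p432202,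
L2-lead R181).  At abc-iut-L2-t4's genuine §5 data `ofConnectedTemperoidData h Q …` with `Q := ThetaSubquotient.autImageStub q ι`
(print's image carrier `(l·Δ_Θ)_E ⊆ Aut^Θ_D(E)`): the chain's binder `hLi` (`Thm56Sub.LDeltaMapId`, unfolded) is a THEOREM
(`lDeltaMap_id_ofConnectedTemperoidData_autImage`), and `hLc` (`Thm56Sub.LDeltaMapComp`) holds ON THE GALOIS LOCUS
(`lDeltaMap_comp_ofConnectedTemperoidData_autImage_of_isGaloisObj`), and the structural leaf `hproj` (transport along `Aut(B_N^bs)`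
is conjugation on `P`) is a THEOREM (`hproj_ofConnectedTemperoidData_autImage`, from abc-iut-w4-d042's `map_autProj_eq_autProj_conj`:
along AUTOMORPHISMS images are always preserved); the ∀-form of `hLc` is NOT expected for this carrier — see the
DUAL CLAUSE note in `ThetaSubquotientOfTemperedAutImage.lean`.  Nothing of [EtTh] is asserted; no side taken on [IUTchIII] Cor. 3.12.
-/

noncomputable section

namespace Literature.AnabelianGeometry.EtaleTheta

namespace ThetaSubquotient

open CategoryTheory Literature.AlgebraicGeometry.Frobenioids Literature.AnabelianGeometry.SemiGraphs
open FrobenioidCyclotomicRigidity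

universe u v w

variable {G : Type u} [Group G] [TopologicalSpace G] {Q : Type v} [Group Q] {Λ : Type w}
  [CommGroup Λ] (q : G →* Q) (ι : Λ →* Q) [ι.range.Normal]

/-- **Along an AUTOMORPHISM of a connected object print's images ARE preserved** (transport along `g` is conjugation on the
`Aut`-subquotient: abc-iut-w4-d042's `map_autProj_eq_autProj_conj`) — so `autImageMap g` is the honest restriction of `map g` at
every connected object, Galois or not.  [cite: MochizukiEtTh2009, Prop 5.5 proof p.328 (PDF p.102)] -/
theorem map_autImage_le_of_aut {E : BTemp G} (hE : IsConnectedObj E) (g : Aut E) :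
    (autImage q ι E).map (map q ι hE hE g.hom) ≤ autImage q ι E := by
  rintro _ ⟨_, ⟨σ, rfl⟩, rfl⟩
  exact ⟨⟨g * (σ : Aut E) * g⁻¹, conj_mem_autPre q ι E g σ.2⟩, (map_autProj_eq_autProj_conj q ι hE g σ).symm⟩

/-- **Law hproj for the image carrier (underlying `Π`-sets)**: `autImageMap g` takes the image point of `σ` to the image point of
`g σ g⁻¹`.  [cite: MochizukiEtTh2009, Prop 5.5 proof p.328 (PDF p.102)] -/
theorem autImageMap_aut_rangeRestrict {E : BTemp G} (hE : IsConnectedObj E) (g : Aut E) (σ : autPre q ι E) :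
    autImageMap q ι hE hE g.hom ((autProj q ι E).rangeRestrict σ) =
      (autProj q ι E).rangeRestrict ⟨g * (σ : Aut E) * g⁻¹, conj_mem_autPre q ι E g σ.2⟩ := by
  apply Subtype.ext
  rw [coe_autImageMap_of_le q ι hE hE g.hom (map_autImage_le_of_aut q ι hE g), MonoidHom.coe_rangeRestrict,
    MonoidHom.coe_rangeRestrict]
  exact map_autProj_eq_autProj_conj q ι hE g σ

/-- **Law hproj for the image carrier over `B^temp(Π)⁰`** (the binder shape of abc-iut-L2-t4's `cyclotomicRigidity_ofConnectedTemperoidData…`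
with `P := ⟨autImagePre, autImageProj⟩`): `∃ hgh, lDeltaMap g (autImageProj σ) = autImageProj (g σ g⁻¹)`, at EVERY connected `E`.
[cite: MochizukiEtTh2009, Prop 5.5 proof p.328 (PDF p.102)] -/
theorem exists_conj_mem_autImagePre_lDeltaMap_autImageProj_eq (E : ConnectedPart (BTemp G)) (g g' : Aut E)
    (hh : g' ∈ autImagePre q ι E) :
    ∃ hgh : g * g' * g⁻¹ ∈ autImagePre q ι E,
      (autImageStub q ι).lDeltaMap g.hom (autImageProj q ι E ⟨g', hh⟩) = autImageProj q ι E ⟨g * g' * g⁻¹, hgh⟩ := by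
  have hgh : g * g' * g⁻¹ ∈ autImagePre q ι E := by
    rw [mem_autImagePre_iff, map_mul, map_mul, map_inv]
    exact conj_mem_autPre q ι E.obj _ hh
  refine ⟨hgh, Subtype.ext ?_⟩
  have key := congrArg Subtype.val (autImageMap_aut_rangeRestrict q ι E.property
    ((connectedObjects (BTemp G)).fullyFaithfulι.autMulEquivOfFullyFaithful E g)
    ⟨(connectedObjects (BTemp G)).fullyFaithfulι.autMulEquivOfFullyFaithful E g', hh⟩)
  refine (Eq.trans rfl key).trans ?_
  rw [MonoidHom.coe_rangeRestrict, coe_autImageProj]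
  congr 1

end ThetaSubquotient

namespace ThetaFrobenioid

open CategoryTheory Opposite Literature.AlgebraicGeometry.Frobenioids Literature.AnabelianGeometry.SemiGraphs
  Literature.AnabelianGeometry.SemiGraphs.GaloisObjects FrobenioidCyclotomicRigidity

universe u₁ v₁ w₁ v₁'

variable {K : Type u₁} [Field K] {X : SemiGraphs.TemperedArithmeticGroup.{u₁} K} {D₀ : Type u₁} [Category.{v₁} D₀]
  {V : FrdIMonoidStub.{max u₁ w₁}} {T₀ : RealifiedDivisorMonoids (D₀ := D₀) V}
  {VD : FrdICatStub.{u₁ + 1, u₁, max u₁ w₁} (ConnectedPart (BTemp X.Pi))}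
  {tf : TemperedFrobenioid T₀ (ConnectedPart (BTemp X.Pi)) VD} {hZ : tf.monoidType = MonoidType.Z}
  {hP : ∀ A : (ConnectedPart (BTemp X.Pi))ᵒᵖ, IsPerfect (tf.Φ.carrier A)}
  {NH : Subgroup (Field.absoluteGaloisGroup K) → tf.category → ℕ+ → Prop} {A₀ : tf.category}
  {hA₀ : PreFrobenioid.IsFrobeniusTrivial tf.toElem A₀} {hA₀' : SemiGraphs.IsGaloisObj A₀.base.obj}
  {pullFrac : ∀ {A A' : (BiKummerSetting.mkOfConnectedTemperoid X tf hZ hP NH A₀ hA₀ hA₀').C} (_ : A' ⟶ A),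
    (BiKummerSetting.mkOfConnectedTemperoid X tf hZ hP NH A₀ hA₀ hA₀').biratUnits A →
      (BiKummerSetting.mkOfConnectedTemperoid X tf hZ hP NH A₀ hA₀ hA₀').biratUnits A'}
  {lv N : ℕ+} {T : ThetaEnvData.{max u₁ w₁} N}
  {θ : (BiKummerSetting.mkOfConnectedTemperoid X tf hZ hP NH A₀ hA₀ hA₀').biratUnits
    (BiKummerSetting.mkOfConnectedTemperoid X tf hZ hP NH A₀ hA₀ hA₀').Aodot}
  {Bl : (BiKummerSetting.mkOfConnectedTemperoid X tf hZ hP NH A₀ hA₀ hA₀').C}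
  {Pl : (BiKummerSetting.mkOfConnectedTemperoid X tf hZ hP NH A₀ hA₀ hA₀').FractionPair θ Bl}
  {Rl : (BiKummerSetting.mkOfConnectedTemperoid X tf hZ hP NH A₀ hA₀ hA₀').NthRoot θ Pl lv pullFrac}
  (h : ModelFrobenioid.Hypotheses tf.divisorMonoid tf.ratFnFunctor)
  {Q' : Type v₁'} [Group Q'] {Λ : Type w₁} [CommGroup Λ] (q : X.Pi →* Q') (ι : Λ →* Q') [ι.range.Normal]
  (odd_l : Odd (lv : ℕ))
  (R : (BiKummerSetting.mkOfConnectedTemperoid X tf hZ hP NH A₀ hA₀ hA₀').NthRoot Rl.root Rl.pair N pullFrac)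
  (ιX : T.PiX ≃ₜ* X.Pi) (K' : Type (max u₁ w₁)) [Field K'] (constEmb : K'ˣ →* tf.biratUnitsModel R.BN)
  (constEmb_injective : Function.Injective constEmb)
  (hinvc : ∀ g : Aut R.AN.base,
    pull tf.divisorMonoid g.hom (ModelFrobenioid.div R.pair.num) = ModelFrobenioid.div R.pair.num)
  (hinvp : ∀ y : T.PiX, y ∈ T.PiYdd →
    pull tf.divisorMonoid ((BiKummerSetting.mkOfConnectedTemperoid X tf hZ hP NH A₀ hA₀ hA₀').galoisSurj R.AN.base
      R.αData.isGalois (ιX y)).hom (ModelFrobenioid.div R.pair.den) = ModelFrobenioid.div R.pair.den)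

/-- Rewriting lemma: the transport of the genuine §5 data with `Q := autImageStub q ι` IS `autImageMap` (definitionally; rewrite with
it before `exact` at this four-deep definitional stack).  [cite: MochizukiEtTh2009, §5 p.327 (PDF p.101)] -/
theorem ofConnectedTemperoidData_autImage_lDeltaMap {E E' : ConnectedPart (BTemp X.Pi)} (f : E ⟶ E') :
    (ofConnectedTemperoidData h (ThetaSubquotient.autImageStub q ι) odd_l R ιX K' constEmb constEmb_injective hinvc
      hinvp).lDeltaMap f = ThetaSubquotient.autImageMap q ι E.property E'.property f.hom := rfl

/-- **The chain's binder `hLi` (`Thm56Sub.LDeltaMapId`, unfolded) is a THEOREM at the genuine §5 data with print's image carrier.**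
[cite: MochizukiEtTh2009, Prop 5.5 proof p.328 (PDF p.102)] -/
theorem lDeltaMap_id_ofConnectedTemperoidData_autImage (E : ConnectedPart (BTemp X.Pi)) :
    (ofConnectedTemperoidData h (ThetaSubquotient.autImageStub q ι) odd_l R ιX K' constEmb constEmb_injective hinvc
      hinvp).lDeltaMap (𝟙 E) = MonoidHom.id _ := by
  rw [ofConnectedTemperoidData_autImage_lDeltaMap]
  exact ThetaSubquotient.autImageMap_id q ι E.property

/-- The chain's binder `hLc` (`Thm56Sub.LDeltaMapComp`) at the genuine §5 data with print's image carrier, ON THE GALOIS LOCUS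
(middle and final objects Galois, `q` onto) — the part that is a theorem; the ∀-form is not expected (DUAL CLAUSE above).
[cite: MochizukiEtTh2009, Prop 5.5 proof p.328 (PDF p.102)] -/
theorem lDeltaMap_comp_ofConnectedTemperoidData_autImage_of_isGaloisObj {E E' E'' : ConnectedPart (BTemp X.Pi)}
    (hE' : IsGaloisObj E'.obj) (hE'' : IsGaloisObj E''.obj) (hq : Function.Surjective q) (f : E ⟶ E') (g : E' ⟶ E'') :
    (ofConnectedTemperoidData h (ThetaSubquotient.autImageStub q ι) odd_l R ιX K' constEmb constEmb_injective hinvc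
      hinvp).lDeltaMap (f ≫ g) =
      ((ofConnectedTemperoidData h (ThetaSubquotient.autImageStub q ι) odd_l R ιX K' constEmb constEmb_injective hinvc
        hinvp).lDeltaMap g).comp
      ((ofConnectedTemperoidData h (ThetaSubquotient.autImageStub q ι) odd_l R ιX K' constEmb constEmb_injective hinvc
        hinvp).lDeltaMap f) := by
  rw [ofConnectedTemperoidData_autImage_lDeltaMap, ofConnectedTemperoidData_autImage_lDeltaMap,
    ofConnectedTemperoidData_autImage_lDeltaMap]
  exact ThetaSubquotient.autImageMap_comp_of_isGaloisObj q ι X.isTempered E.property hE' hE'' hq f.hom g.hom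

/-- `proj` of the `P` term at an object `E` IS `autImageProj` (definitionally). [cite: MochizukiEtTh2009, §5 p.327 (PDF p.101)] -/
theorem thetaSubquotientProjOfConnectedTemperoidDataAutImage_proj (E : ConnectedPart (BTemp X.Pi)) :
    (thetaSubquotientProjOfConnectedTemperoidDataAutImage h q ι odd_l R ιX K' constEmb constEmb_injective hinvc hinvp).proj E =
      ThetaSubquotient.autImageProj q ι E := rfl

/-- **The chain's structural leaf `hproj` is a THEOREM at the genuine §5 data with print's image carrier and the `P` term**
(binder shape of abc-iut-L2-t4's `cyclotomicRigidity_ofConnectedTemperoidData_of_pullRoot`, p430047, verbatim): transport along an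
automorphism `g` of `B_N^bs` is conjugation on `P`.  [cite: MochizukiEtTh2009, Prop 5.5 proof p.328 (PDF p.102)] -/
theorem hproj_ofConnectedTemperoidData_autImage :
    ∀ (g g' : Aut ((ofConnectedTemperoidData h (ThetaSubquotient.autImageStub q ι) odd_l R ιX K' constEmb constEmb_injective
        hinvc hinvp).base.obj
        (ofConnectedTemperoidData h (ThetaSubquotient.autImageStub q ι) odd_l R ιX K' constEmb constEmb_injective hinvc hinvp).BN))
      (hh : g' ∈ (thetaSubquotientProjOfConnectedTemperoidDataAutImage h q ι odd_l R ιX K' constEmb constEmb_injective hinvc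
        hinvp).pre _),
      ∃ hgh : g * g' * g⁻¹ ∈ (thetaSubquotientProjOfConnectedTemperoidDataAutImage h q ι odd_l R ιX K' constEmb
          constEmb_injective hinvc hinvp).pre _,
        (ofConnectedTemperoidData h (ThetaSubquotient.autImageStub q ι) odd_l R ιX K' constEmb constEmb_injective hinvc
            hinvp).lDeltaMap g.hom
          ((thetaSubquotientProjOfConnectedTemperoidDataAutImage h q ι odd_l R ιX K' constEmb constEmb_injective hinvc
            hinvp).proj _ ⟨g', hh⟩) =
          (thetaSubquotientProjOfConnectedTemperoidDataAutImage h q ι odd_l R ιX K' constEmb constEmb_injective hinvc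
            hinvp).proj _ ⟨g * g' * g⁻¹, hgh⟩ := by
  intro g g' hh
  rw [ofConnectedTemperoidData_autImage_lDeltaMap, thetaSubquotientProjOfConnectedTemperoidDataAutImage_proj]
  exact ThetaSubquotient.exists_conj_mem_autImagePre_lDeltaMap_autImageProj_eq q ι _ g g' hh

end ThetaFrobenioid

end Literature.AnabelianGeometry.EtaleTheta

end
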